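import Summits.CriticalPhenomena.PercolationContinuityZ3.Theorems.Transplant.PlanarCells2SDefs
import HarnessLib

/-!
# N2 (frames-only node `SamePDropOfSkeletonFrm₁`, OPEN), Geom foundation under (R-22)/(R-40): TWO-UNIT PLANAR CELLS WITH STAGGERED CENTRES AND A
# PER-AXIS CREEP CAP `PCells2T` — the (R-40) successor of `PCells2S` (PlanarCells2SDefs, p3-g15)

RULING (R-40) (design owner p3-g16, 2026-08-23T06:23:56Z; J18 located by stmt-g20 05:48:59Z, sieve p5-g16 06:18:57Z): the first-axis K-G arrival needs a
transverse creep `c 0 ≈ (0.5…10)·s₁`, which the UNIFORM cap of `PCells2S` (`c i ≤ cmax ≤ r j` for every `j`, i.e. `≤ K·min(s₀,s₁)`) refuses for flat boxes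
`s₁ ≳ 2K·s₀`; but every geometric consumer only ever multiplies the creep of a step along axis `i` against the OTHER coordinate (`cenS v j = 20·r_j·v j +
c (oth j)·v (oth j)`), so the cap the geometry eats is the PER-AXIS one, **`c i ≤ r (oth i)`**.  This file is that successor structure: `PCells2T` :=
`PCells2` + `c` + `hc0 : 0 ≤ c i` + `hcr : c i ≤ r (oth i)` (no `cmax`); the staggered centre `cenS` and the whole box family of `PlanarCells2SDefs` §2
VERBATIM (same names, namespace `PCells2T`), the 2D separation in the per-axis form `cenS_sep : u ≠ v → ∃ j, 20·r_j − c (oth j) ≤ |cenS v j − cenS u j|`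
(same proof: in the coordinate `j` with the larger index gap the perturbation is `c (oth j)·Δv_(oth j)`, `|Δv_(oth j)| ≤ |Δv_j|`), `cenS_sep'` (`≥ 19 r_j`)
unchanged; and the embedding `PCells2S.toT` (a uniformly capped family is per-axis capped), `toT_cenS : P.toT.cenS = P.cenS` — so every `…S` fact is an
instance of its `…T` twin and nothing landed is invalidated.  NO landed file is edited; the `…T` twins of the S layer (SFar/ContainS/SArm/SepS/SepInfS/LevelsS/
EfarN2S/FaceRowsS/BoundsS, the Skel Geom layer, Rooms, the (F) face column) follow as separate successor files (hp-8 g42, port owner per (R-40)).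
NON-VACUITY (lead g11 standing order 2026-08-23T03:52:56Z): a structure file; witness = stmt's `fcellsT` at the tuple of record (`c 0 ≤ r 1 = K·s₁`,
`c 1 ≤ r 0`), exactly as `fcellsS` witnessed `PCells2S`; `PCells2S.toT` of any landed S-instance is a second witness.
builds on p205010 (kernel theorem, internal audit signed; external expert review pending) — nothing in this file uses p205010; nothing here is a
claim about the open node `SamePDropOfSkeletonFrm₁`.
Lane `prim-bschramm`, seat `prim-hp-8` (gen 42; (R-40) port owner); helper file (`--supports stmt-CriticalPhenomena-4575 --as helper`); design owner p3-g16.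
* §1 `PCells2T`, `cenS`, `cenS_apply/zero/congr`, `cenS_add_stepVec_fst`, `cenS_add_stepVec_oth`, `c_nonneg`, `c_le_r_oth'` (`c i ≤ r (oth i)`),
  `c_oth_le_r` (`c (oth j) ≤ r j`), `abs_c_oth_le`, **`cenS_sep`** (per-axis form), `cenS_sep'`, `cenS_eq_cen_of_zero`; `PCells2S.toT`, `toT_c/toT_r/toT_cenS`;
* §2 the box family about `cenS` (verbatim intervals and names of PlanarCells2SDefs §2), `mem_aboxS_iff`, `Icc_faceLo_faceHi`, `cenS_mem`.
[cite: KozmaNitzan2024, §4 pp. 25–26 (Q_v, M_v, E_{v,x}, H^j_{v,x}), p. 30 (F^j_{v,x})]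
-/

noncomputable section

namespace Summit.CriticalPhenomena.PercolationContinuityZ3.Theorems

namespace Transplant

open Literature.Probability.Percolation Literature.Probability.LatticeModels SimpleGraph GadgetSystem Contour
open Literature.Probability.Percolation.KozmaNitzan
open Literature.Probability.Percolation.KozmaNitzan.Cells (oth oth_ne sgOf sgOf_sign stepVec_apply_fst stepVec_apply_oth eq_oth_of_ne oth_oth
  eq_of_coords)
open PCells (mem_psBox_iff)

/-! ## §1 Staggered two-unit cells with a per-axis creep cap -/

/-- **Two-unit planar cells with staggered centres and a PER-AXIS creep cap** ((R-40)): `PCells2` plus the creep `c i` of a unit macro-step along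
axis `i` (felt on the other coordinate, toward the onward quadrant), `0 ≤ c i ≤ r (oth i)`. [this work] -/
structure PCells2T extends PCells2 where
  /-- the creep of a unit step along axis `i`, felt on the other coordinate -/
  c : Fin 2 → ℤ
  /-- the creep points toward the onward quadrant -/
  hc0 : ∀ i, 0 ≤ c i
  /-- the creep of a step along `i` is at most the unit of the OTHER axis -/
  hcr : ∀ i, c i ≤ toPCells2.r (oth i)

namespace PCells2T


/-- The staggered centre: `cenS v j = 20·r_j·v j + c (oth j)·v (oth j)`. [this work] -/
def cenS (P : PCells2T) (v : Site 2) : Site 2 := fun j => 20 * (P.r j : ℤ) * v j + P.c (oth j) * v (oth j)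

/-- The staggered centre, coordinatewise. [folklore] -/
@[simp] theorem cenS_apply (P : PCells2T) (v : Site 2) (j : Fin 2) : P.cenS v j = 20 * (P.r j : ℤ) * v j + P.c (oth j) * v (oth j) := rfl

/-- `cenS 0 = 0`. [folklore] -/
@[simp] theorem cenS_zero (P : PCells2T) : P.cenS 0 = 0 := by funext j; simp

/-- Equal macro-vertices have equal centres (congruence in both coordinates). [folklore] -/
theorem cenS_congr (P : PCells2T) {u v : Site 2} (h : u = v) : P.cenS u = P.cenS v := by rw [h]

/-- With zero creep the staggered centre is `PCells2`'s centre. [folklore] -/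
theorem cenS_eq_cen_of_zero (P : PCells2T) (h : ∀ i, P.c i = 0) (v : Site 2) : P.cenS v = P.toPCells2.cen v := by
  funext j; simp [cenS_apply, h]

/-- `0 ≤ c i`. [folklore] -/
theorem c_nonneg (P : PCells2T) (i : Fin 2) : 0 ≤ P.c i := P.hc0 i

/-- The per-axis cap: `c i ≤ r (oth i)`. [folklore] -/
theorem c_le_r_oth' (P : PCells2T) (i : Fin 2) : P.c i ≤ (P.r (oth i) : ℤ) := P.hcr i

/-- The per-axis cap read from the receiving coordinate: `c (oth j) ≤ r j`. [folklore] -/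
theorem c_oth_le_r (P : PCells2T) (j : Fin 2) : P.c (oth j) ≤ (P.r j : ℤ) := by
  have := P.hcr (oth j); rwa [oth_oth] at this

/-- `|c (oth j)| ≤ r j`. [folklore] -/
theorem abs_c_oth_le (P : PCells2T) (j : Fin 2) : |P.c (oth j)| ≤ (P.r j : ℤ) := abs_le.2 ⟨by linarith [P.hc0 (oth j), P.c_oth_le_r j], P.c_oth_le_r j⟩

/-- **Along the step axis the centre moves by `20 r`.** [folklore] -/
theorem cenS_add_stepVec_fst (P : PCells2T) (v : Site 2) (δ : MDir) :
    PCells2T.cenS P (v + stepVec δ) δ.1 = PCells2T.cenS P v δ.1 + sgOf δ * (20 * (P.r δ.1 : ℤ)) := by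
  simp only [cenS_apply, Pi.add_apply, stepVec_apply_fst, stepVec_apply_oth, add_zero]; ring

/-- **Across the step axis the centre CREEPS by `sgOf δ · c δ.1`.** [this work] -/
theorem cenS_add_stepVec_oth (P : PCells2T) (v : Site 2) (δ : MDir) :
    PCells2T.cenS P (v + stepVec δ) (oth δ.1) = PCells2T.cenS P v (oth δ.1) + sgOf δ * P.c δ.1 := by
  simp only [cenS_apply, Pi.add_apply, stepVec_apply_oth, add_zero, oth_oth, stepVec_apply_fst]; ring

/-- **2D separation of staggered centres, per-axis form**: distinct macro-vertices have, in the coordinate `j` with the larger index gap, centres at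
distance at least `20 r_j − c (oth j)` (`≥ 19 r_j`). [this work] -/
theorem cenS_sep (P : PCells2T) {u v : Site 2} (h : u ≠ v) : ∃ j : Fin 2, 20 * (P.r j : ℤ) - P.c (oth j) ≤ |P.cenS v j - P.cenS u j| := by
  have hne : ∃ j : Fin 2, u j ≠ v j := by
    by_contra hall
    push Not at hall
    exact h (funext fun j => hall j)
  set g0 : ℤ := v 0 - u 0 with hg0
  set g1 : ℤ := v 1 - u 1 with hg1
  have h01 : oth (0 : Fin 2) = 1 := by decide
  have h10 : oth (1 : Fin 2) = 0 := by decide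
  have hc1 : (0 : ℤ) ≤ P.c 1 := P.hc0 1
  have hc0 : (0 : ℤ) ≤ P.c 0 := P.hc0 0
  rcases le_total |g1| |g0| with hle | hle
  · have hg : 1 ≤ |g0| := by
      rcases hne with ⟨j, hj⟩
      fin_cases j
      · exact Int.one_le_abs (sub_ne_zero.2 (Ne.symm hj))
      · exact le_trans (Int.one_le_abs (sub_ne_zero.2 (Ne.symm hj))) hle
    refine ⟨0, ?_⟩
    rw [h01]
    have e : P.cenS v 0 - P.cenS u 0 = 20 * (P.r 0 : ℤ) * g0 + P.c 1 * g1 := by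
      simp only [cenS_apply, h01, hg0, hg1]; ring
    rw [e]
    have h1 : |P.c 1 * g1| ≤ P.c 1 * |g0| := by
      rw [abs_mul, abs_of_nonneg hc1]; exact mul_le_mul_of_nonneg_left hle hc1
    have h3 := abs_sub_abs_le_abs_sub (20 * (P.r 0 : ℤ) * g0) (-(P.c 1 * g1))
    rw [sub_neg_eq_add, abs_neg, abs_mul, abs_of_nonneg (by positivity : (0 : ℤ) ≤ 20 * (P.r 0 : ℤ))] at h3
    have hr : (0 : ℤ) ≤ 20 * (P.r 0 : ℤ) - P.c 1 := by have := P.c_oth_le_r 0; rw [h01] at this; linarith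
    nlinarith [abs_nonneg g0]
  · have hg : 1 ≤ |g1| := by
      rcases hne with ⟨j, hj⟩
      fin_cases j
      · exact le_trans (Int.one_le_abs (sub_ne_zero.2 (Ne.symm hj))) hle
      · exact Int.one_le_abs (sub_ne_zero.2 (Ne.symm hj))
    refine ⟨1, ?_⟩
    rw [h10]
    have e : P.cenS v 1 - P.cenS u 1 = 20 * (P.r 1 : ℤ) * g1 + P.c 0 * g0 := by
      simp only [cenS_apply, h10, hg0, hg1]; ring
    rw [e]
    have h1 : |P.c 0 * g0| ≤ P.c 0 * |g1| := by
      rw [abs_mul, abs_of_nonneg hc0]; exact mul_le_mul_of_nonneg_left hle hc0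
    have h3 := abs_sub_abs_le_abs_sub (20 * (P.r 1 : ℤ) * g1) (-(P.c 0 * g0))
    rw [sub_neg_eq_add, abs_neg, abs_mul, abs_of_nonneg (by positivity : (0 : ℤ) ≤ 20 * (P.r 1 : ℤ))] at h3
    have hr : (0 : ℤ) ≤ 20 * (P.r 1 : ℤ) - P.c 0 := by have := P.c_oth_le_r 1; rw [h10] at this; linarith
    nlinarith [abs_nonneg g1]

/-- **Separation, usable form**: for `u ≠ v` some coordinate of the centres differs by at least `19 r_j`. [this work] -/
theorem cenS_sep' (P : PCells2T) {u v : Site 2} (h : u ≠ v) : ∃ j : Fin 2, 19 * (P.r j : ℤ) ≤ |P.cenS v j - P.cenS u j| := by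
  obtain ⟨j, hj⟩ := P.cenS_sep h
  have := P.c_oth_le_r j
  exact ⟨j, by linarith⟩

end PCells2T

/-! ### The embedding of the uniformly capped cells -/

namespace PCells2S

/-- **A uniformly capped family is per-axis capped**: `PCells2S ↪ PCells2T` (`c i ≤ cmax ≤ r (oth i)`). [folklore] -/
def toT (P : PCells2S) : PCells2T where
  toPCells2 := P.toPCells2
  c := P.c
  hc0 := P.hc0
  hcr := fun i => (P.hcm i).trans (by exact_mod_cast P.hcr (oth i))

/-- The embedding keeps the creep. [folklore] -/
@[simp] theorem toT_c (P : PCells2S) : P.toT.c = P.c := rfl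

/-- The embedding keeps the underlying two-unit cells. [folklore] -/
@[simp] theorem toT_toPCells2 (P : PCells2S) : P.toT.toPCells2 = P.toPCells2 := rfl

/-- The embedding keeps the staggered centre. [folklore] -/
@[simp] theorem toT_cenS (P : PCells2S) : P.toT.cenS = P.cenS := by
  funext v j; rfl

end PCells2S

namespace PCells2T


/-! ## §2 The boxes about the staggered centre (the intervals of `PlanarCells2Defs`, verbatim) -/

/-- `Q_v = cenS v + [−5r₀, 5r₀] × [−5r₁, 5r₁]`. [cite: KozmaNitzan2024, §4 p. 26 (Q_v)] -/
def Q (P : PCells2T) (v : Site 2) : Finset (Site 2) := Finset.Icc (P.cenS v - P.hw 5) (P.cenS v + P.hw 5)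

/-- `M_v = cenS v + [−3r₀, 3r₀] × [−3r₁, 3r₁]` (KN's cube; the (C) corridor's ARRIVAL box is the smaller parking box of the scheme, slots `bα, bβ`). [cite: KozmaNitzan2024, §4 p. 26 (M_v)] -/
def M (P : PCells2T) (v : Site 2) : Finset (Site 2) := Finset.Icc (P.cenS v - P.hw 3) (P.cenS v + P.hw 3)

/-- The cell `cenS v + [−10r₀, 10r₀] × [−10r₁, 10r₁]` (diagonal neighbours may share a `c 1 × c 0` corner — see the module docstring). [folklore] -/
def Cell (P : PCells2T) (v : Site 2) : Finset (Site 2) := Finset.Icc (P.cenS v - P.hw 10) (P.cenS v + P.hw 10)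

/-- The between-box `cenS v + {5r∥ < σ x_a < 15r∥} × [−5r⊥, 5r⊥]`. [cite: KozmaNitzan2024, §4 p. 26 (E_{v,x})] -/
def Btw (P : PCells2T) (v : Site 2) (δ : MDir) : Finset (Site 2) :=
  sBox δ.1 (sgOf δ) (P.cenS v) (5 * P.r δ.1 + 1) (15 * P.r δ.1 - 1) (5 * P.r (oth δ.1))

/-- `E^far_{v,x} = cenS v + {5r∥ < σ x_a ≤ 25r∥} × [−5r⊥, 5r⊥]`. [cite: KozmaNitzan2024, §4 p. 26 (E_{v,x})] -/
def Efar (P : PCells2T) (v : Site 2) (δ : MDir) : Finset (Site 2) :=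
  sBox δ.1 (sgOf δ) (P.cenS v) (5 * P.r δ.1 + 1) (25 * P.r δ.1) (5 * P.r (oth δ.1))

/-- `E_{v,x} = Btw ∪ Q_x` (the target's `Q` about the STAGGERED neighbour centre). [cite: KozmaNitzan2024, §4 p. 26 (E_{v,x})] -/
def Ewv (P : PCells2T) (v : Site 2) (δ : MDir) : Finset (Site 2) := P.Btw v δ ∪ P.Q (v + stepVec δ)

/-- The stub `H^j_{v,x} = cenS v + {5r∥ ≤ σ x_a ≤ 5r∥ + 10 s∥ j} × [−2r⊥, 2r⊥]`. [cite: KozmaNitzan2024, §4 p. 26 (H^j_{v,x})] -/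
def Stub (P : PCells2T) (v : Site 2) (δ : MDir) (j : ℕ) : Finset (Site 2) :=
  sBox δ.1 (sgOf δ) (P.cenS v) (5 * P.r δ.1) (5 * P.r δ.1 + 10 * P.s δ.1 * j) (2 * P.r (oth δ.1))

/-- The stub zone `cenS v + {10r∥ ≤ σ x_a ≤ 15r∥ − 10s∥} × [−2r⊥, 2r⊥]`. [cite: KozmaNitzan2024, §4 p. 26] -/
def Zone (P : PCells2T) (v : Site 2) (δ : MDir) : Finset (Site 2) :=
  sBox δ.1 (sgOf δ) (P.cenS v) (10 * P.r δ.1) (15 * P.r δ.1 - 10 * P.s δ.1) (2 * P.r (oth δ.1))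

/-- The face `F^j_{v,x} = cenS v + {σ x_a = 5r∥ + 10s∥j} × [−2r⊥, 2r⊥]`. [cite: KozmaNitzan2024, §4 p. 30 (F^j_{v,x})] -/
def Face (P : PCells2T) (v : Site 2) (δ : MDir) (j : ℕ) : Finset (Site 2) :=
  sBox δ.1 (sgOf δ) (P.cenS v) (5 * P.r δ.1 + 10 * P.s δ.1 * j) (5 * P.r δ.1 + 10 * P.s δ.1 * j) (2 * P.r (oth δ.1))

/-- The full corridor `H_{v,x} = cenS v + {5r∥ ≤ σ x_a ≤ 22r∥} × [−2r⊥, 2r⊥]`. [cite: KozmaNitzan2024, §4 p. 26 (H_{v,x})] -/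
def Hfull (P : PCells2T) (v : Site 2) (δ : MDir) : Finset (Site 2) :=
  sBox δ.1 (sgOf δ) (P.cenS v) (5 * P.r δ.1) (22 * P.r δ.1) (2 * P.r (oth δ.1))

/-- The narrow between-box `cenS v + {5r∥ < σ x_a < 15r∥} × [−(5r⊥−1), 5r⊥−1]`. [cite: KozmaNitzan2024, §4 p. 26 (E_{v,x})] -/
def BtwN (P : PCells2T) (v : Site 2) (δ : MDir) : Finset (Site 2) :=
  sBox δ.1 (sgOf δ) (P.cenS v) (5 * P.r δ.1 + 1) (15 * P.r δ.1 - 1) (5 * P.r (oth δ.1) - 1)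

/-- The narrow far region `cenS v + {5r∥ < σ x_a ≤ 25r∥} × [−(5r⊥−1), 5r⊥−1]`. [cite: KozmaNitzan2024, §4 p. 26 (E_{v,x})] -/
def EfarN (P : PCells2T) (v : Site 2) (δ : MDir) : Finset (Site 2) :=
  sBox δ.1 (sgOf δ) (P.cenS v) (5 * P.r δ.1 + 1) (25 * P.r δ.1) (5 * P.r (oth δ.1) - 1)

/-- The narrow `E_{v,x} = BtwN ∪ Q_x`. [cite: KozmaNitzan2024, §4 p. 26 (E_{v,x})] -/
def EwvN (P : PCells2T) (v : Site 2) (δ : MDir) : Finset (Site 2) := P.BtwN v δ ∪ P.Q (v + stepVec δ)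

/-- The narrow fresh rows above the stub of level `j`. [cite: KozmaNitzan2024, §4 p. 30] -/
def farAN (P : PCells2T) (x : Site 2) (du : MDir) (j : ℕ) : Finset (Site 2) :=
  sBox du.1 (sgOf du) (P.cenS x) (5 * P.r du.1 + 10 * P.s du.1 * j + 1) (25 * P.r du.1) (5 * P.r (oth du.1) - 1)

/-- The shrunk far rows (one unit inside `farAN` on every side). [cite: KozmaNitzan2024, §4 p. 30 (the rows above H^j)] -/
def farAS (P : PCells2T) (x : Site 2) (du : MDir) (j : ℕ) : Finset (Site 2) :=
  sBox du.1 (sgOf du) (P.cenS x) (5 * P.r du.1 + 10 * P.s du.1 * j + 2) (25 * P.r du.1 - 1) (5 * P.r (oth du.1) - 2)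

/-- The level of `t` along `δ` from `v`: `σ (t_a − cenS v_a)`. [cite: KozmaNitzan2024, §4 p. 30] -/
def lev (P : PCells2T) (δ : MDir) (v : Site 2) (t : Site 2) : ℤ := sgOf δ * (t δ.1 - P.cenS v δ.1)

/-- Lower corner of the shifted face row about the staggered centre. [folklore] -/
def faceLo (P : PCells2T) (x : Site 2) (du : MDir) (j : ℕ) : Site 2 := sLo du.1 (sgOf du) (P.cenS x) (P.faceL du.1 j) (P.faceL du.1 j) (2 * P.r (oth du.1))

/-- Upper corner of the shifted face row about the staggered centre. [folklore] -/
def faceHi (P : PCells2T) (x : Site 2) (du : MDir) (j : ℕ) : Site 2 := sHi du.1 (sgOf du) (P.cenS x) (P.faceL du.1 j) (P.faceL du.1 j) (2 * P.r (oth du.1))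

/-- The narrow planar world of the probe `v → v+δ → v+δ+du` about staggered centres (the target's cube and corridor move with the staggered
neighbour `v + δ`). [cite: KozmaNitzan2024, §4 p. 26 (E_{v,x}, H_{x,y})] -/
def probeWorldN (P : PCells2T) (v : Site 2) (δ du : MDir) : Finset (Site 2) := P.BtwN v δ ∪ P.Q (v + stepVec δ) ∪ P.Hfull (v + stepVec δ) du

/-! ### Membership -/

/-- Membership in a staggered-centred anisotropic box of half-widths `(n r₀, n r₁)`. [folklore] -/
theorem mem_aboxS_iff (P : PCells2T) {v : Site 2} {n : ℕ} {t : Site 2} :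
    t ∈ Finset.Icc (P.cenS v - P.hw n) (P.cenS v + P.hw n) ↔ ∀ i, P.cenS v i - (n * P.r i : ℕ) ≤ t i ∧ t i ≤ P.cenS v i + (n * P.r i : ℕ) := by
  rw [mem_Icc_iff]
  refine forall_congr' fun i => ?_
  simp only [Pi.sub_apply, Pi.add_apply, PCells2.hw_apply]

/-- The shifted face row about the staggered centre as a signed box. [folklore] -/
theorem Icc_faceLo_faceHi (P : PCells2T) (x : Site 2) (du : MDir) (j : ℕ) :
    Finset.Icc (P.faceLo x du j) (P.faceHi x du j) = sBox du.1 (sgOf du) (P.cenS x) (P.faceL du.1 j) (P.faceL du.1 j) (2 * P.r (oth du.1)) := rfl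

/-- The centre lies in its own `Q`, `M` and `Cell`. [folklore] -/
theorem cenS_mem (P : PCells2T) (v : Site 2) : P.cenS v ∈ P.Q v ∧ P.cenS v ∈ P.M v ∧ P.cenS v ∈ P.Cell v := by
  simp only [Q, M, Cell, mem_aboxS_iff]
  refine ⟨fun i => ⟨?_, ?_⟩, fun i => ⟨?_, ?_⟩, fun i => ⟨?_, ?_⟩⟩ <;> simp


end PCells2T

end Transplant

end Summit.CriticalPhenomena.PercolationContinuityZ3.Theorems

end
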